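import Summits.BirchSwinnertonDyer.BirchSwinnertonDyer.Theorems.EisensteinPrimesMazurMCOnCellBTwistbackOnePartnerCertificates
import Summits.BirchSwinnertonDyer.Rank1Residual.X2.RouteGSplitDisplay5568g1Local
import Summits.BirchSwinnertonDyer.Rank1Residual.Partition.EisensteinKernelAbscissaType
import Literature.NumberTheory.EllipticCurves.TateCurve.NumberFieldUniformization
import Literature.NumberTheory.EllipticCurves.TateCurve.NumberFieldUniformizationTwisted
import Literature.NumberTheory.EllipticCurves.HeegnerHypothesisKroneckerProofs
import Literature.NumberTheory.EllipticCurves.HeegnerFieldOfDiscriminantProofs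
import Mathlib.Tactic.NormNum.LegendreSymbol
import HarnessLib

/-!
# Crux 3 `MazurMCOnCellB` (stmt-BirchSwinnertonDyer-19033), line `twistback`: the FIRST A10 non-split cell through the
# per-pair door — `X2.MazurMainConjectureAt 5568g1 3` from STEP L at ONE Heegner datum over `K = ℚ(√−23)` and the
# two-engine certificate `(μ_an, λ_an)(E^{(−23)}, 3) = (0, 1)` of its TYPE-B PARTNER, everything else in the kernel

Seat `bsd-eis-lam-a` g16 (PART 1b seat (4), CONSTRUCTION seat; census ask CA-g9-1 of LEAD `bsd-line-x2-p1` g9). A per-pair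
DISPLAY on the template of the route-G displays (`X2/RouteGSplitDisplay5568g1.lean`, p-ids of record), but through the door
`…TwistbackOnePartnerCertificates.mazurMainConjectureAt_of_cellB_of_not_split_of_indexLowerBoundAt_of_lamMin_twist`
(p642512 §5, LEAD g9): the pair `(5568g1, 3)` — row A10 NON-split (`r_an = 0`, `3 ‖ N = 2⁶·3·29` non-split, `E[3]`
reducible by the rational `Ψ₃`-root `33`, type A = `¬GVPar`: the rational `3`-line is unramified at `3` and EVEN, character
`χ₈`) — with the partner field `K = ℚ(√−23)` (`d_K = −23` odd `< −4`; `2, 3, 29` split in `K`: `−23 ≡ 1 (8)`, `(−23/3) =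
(−23/29) = +1`) and the partner `Wd = 5568g1 ⊗ χ_{−23} = [0, −1, 0, −260844257, −7644351037599]` (minimal model, conductor
`5568·23² = 2 945 472`; an X2c ∩ `GVPar` pair, NON-split at `3` because `3` splits in `K`).

KERNEL-PROVED here (no hypothesis): `X2.CellB 5568g1 3` given the rank reading (ellipticity and global minimality of both
equations — bounded Kraus–Silverman criterion, `decide` —, `3` multiplicative and non-split, `E[3]` reducible, and
`¬ GVPar` from the ABSCISSA ALONE: `x₀ = 33 ∈ ℤ` with `b₂ + 12x₀ = 392 > 0`, `KernelDisc.gvPar_three_iff_abscissa_of_mult`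
with the Tate-uniformisation facts DISCHARGED in the tree); `IsImaginaryQuadratic K`, `Odd d_K`, `d_K < −4` and the Heegner
hypothesis for `5568` and for `3` from `d_K = −23` by the Kronecker criterion (`satisfiesHeegnerHypothesis_iff_kronecker`:
`(−23) mod 8 = 1`, `jacobiSym (−23) 3 = jacobiSym (−23) 29 = 1`); and the twist identity `⟨1, −8, 0, 0⟩⁻¹ • Wd =
5568g1.quadraticTwist (−23)`.
PER-PAIR HYPOTHESES LEFT (instrument readings / data, not mathematics of this file; seat evidence `HOME/lam-a-g16/ca/`,
MEMO-16): `hr : r_an(5568g1) = 0` [Cremona `allbsd`; `L(E,1)/Ω = 1/…` non-zero]; `hN : N(5568g1) = 5568` [Cremona; the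
additive conductor exponent `f₂ = 6` is not re-derived here]; `hrd : r_an(Wd) = 1` [PARI `ellanalyticrank`, kit j311785:
root number `−1`, `L′(Wd, 1) = 3.2790969…`]; `hμ0 : μ_an(Wd) ≤ 0` and `hlam : λ_an(Wd) = 1` for THE non-split
Mazur–Tate–Teitelbaum `3`-adic `L`-function of `Wd` in the tree's normalisation `ϖ·L` [TWO ENGINES, kit j311896 / j311944
(ENGINE T: twisted Birch sum from `5568g1`'s minus modular symbol, eclib; `V = 1 < φ = 54` at `m = 5`, π-adic = norm;
total mass `0`; `v₃(L′(0)) = 0` in the `T`-variable) ‖ kit j312229 (PARI `ellpadiclambdamu(E, 3, −23) = [λ, μ] = [1, 0]`, `ellpadicL`: `L(0) = O(3⁷)`, `v₃(L′(0)) = 1` in the `s`-variable = `0 + v₃(log₃ 4)`); PREDICTED `(0, c(E) + 2λ₃(ℚ(√−184)))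
= (0, 1 + 0)` by LEAD g9's Greenberg–Vatsal λ-formula before the reading]; the Heegner DATUM over `K` (`Dt`, `H`, `ι`,
`P`, `hPt`, `hcM : 3 ∤ c`) and STEP L at that datum `hlow` (= item -27489 there: a theorem MODULO Keller–Yin Thm. D
[PREPRINT] + PUB, p636685); CLASS-LEVEL inputs BY NAME: the route's `PublishedInputs` (item 19037) and Disegni 2020
Thm. 4(1) (`hDis`, PUBLISHED).
HONEST FRAMING: nothing is booked; `(5568g1, 3)` stays OPEN (the PRE input KY Thm. D and the Heegner datum are hypotheses);
Mazur's main conjecture / BSD is proved for NO curve by this file; no summit statement is proved; 0 cells / labels / tiers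
move. What it shows: the LEAD's per-pair door INSTANTIATES on a census cell with every decidable side condition discharged
in the kernel, so an A10 non-split cell reads «KY Thm. D + one Heegner datum + four instrument readings».
References: [GreenbergVatsal2000] Thm. (1.3), p. 4; [Disegni2020] Thm. 4 (§3.2); [SteinWuthrich2013] Thm. 6.1;
[Wuthrich2014] Thm. 16; [SilvermanATAEC1994] Thm. V.5.3, Cor. V.5.4; [GrossLMS1991] §1; Cremona `ecdata` (class 5568g).
-/

set_option autoImplicit false

-- `Summit.BirchSwinnertonDyer.BirchSwinnertonDyer.…`: the summit and its single sub-problem share a name.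
set_option linter.dupNamespace false

noncomputable section

open scoped Classical

open WeierstrassCurve NumberField
  Literature.NumberTheory.EllipticCurves
  Literature.NumberTheory.EllipticCurves.ModularForms
  Literature.NumberTheory.EllipticCurves.Rank1Residual
  Literature.NumberTheory.EllipticCurves.Rank1Residual.Typed
  Literature.NumberTheory.EllipticCurves.Disegni2020
  Literature.NumberTheory.EllipticCurves.TateCurve
  Summit.BirchSwinnertonDyer.BirchSwinnertonDyer.Rank1Residual.IntModel
  Summit.BirchSwinnertonDyer.BirchSwinnertonDyer.Rank1Residual.X11RankOne
  Summit.BirchSwinnertonDyer.Rank1Residual.X11b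
  Summit.BirchSwinnertonDyer.Rank1Residual
  Summit.BirchSwinnertonDyer.Rank1Residual.X2.RouteGSplitDisplay5568g1Local
  Summit.BirchSwinnertonDyer.BirchSwinnertonDyer.Theses
  Summit.BirchSwinnertonDyer.BirchSwinnertonDyer.Theorems.EisensteinPrimesMazurMCOnCellBTwistbackOnePartnerCertificates

namespace Summit.BirchSwinnertonDyer.BirchSwinnertonDyer.Theorems.EisensteinPrimesMazurMCOnCellBTwistbackDisplay5568g1

/-! ## §1 The cell `(5568g1, 3)` is X2b with every decidable clause in the kernel -/

/-- **`x₀ = 33` is a rational root of `Ψ₃(5568g1)`** (`Ψ₃ = 3x⁴ + b₂x³ + 3b₄x² + 3b₆x + b₈` with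
`(b₂, b₄, b₆, b₈) = (−4, −986178, 2513828484, −973136710401)`). [folklore] -/
theorem eval_Ψ₃_5568g1 : (⟨0, -1, 0, -493089, 628457121⟩ : WeierstrassCurve ℚ).Ψ₃.eval 33 = 0 := by
  norm_num [WeierstrassCurve.Ψ₃, WeierstrassCurve.b₂, WeierstrassCurve.b₄, WeierstrassCurve.b₆,
    WeierstrassCurve.b₈]

/-- **`¬ GVPar (5568g1) 3` — the type-A datum of row A10 IN THE KERNEL, from the abscissa alone**: the `Ψ₃`-root
`x₀ = 33` is an INTEGER with `b₂ + 12·x₀ = 392 > 0`, so `KernelDisc.gvPar_three_iff_abscissa_of_mult` (`GVPar W 3 ↔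
(0 < b₂ + 12x₀ ↔ den x₀ ≠ 1)`, Tate uniformisation discharged in the tree) leaves `True ↔ False`. (The line through
`x₀` has character `χ₈`: unramified at `3` and even.) [cite: SilvermanATAEC1994, Thm. V.5.3 and Cor. V.5.4]
[cite: GreenbergVatsal2000, Thm. (1.3) (hypothesis on Φ)] -/
theorem not_gvPar_5568g1 : ¬ GVPar (⟨0, -1, 0, -493089, 628457121⟩ : WeierstrassCurve ℚ) 3 := by
  haveI := isElliptic_5568g1
  haveI := isGloballyMinimal_5568g1
  intro h
  have key := (KernelDisc.gvPar_three_iff_abscissa_of_mult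
    (W := (⟨0, -1, 0, -493089, 628457121⟩ : WeierstrassCurve ℚ))
    Silverman1994_thmV53_tateUniformisation_holds Silverman1994_thmV53_corV54_tateUniformisation_holds
    nonsplit_5568g1.1 eval_Ψ₃_5568g1).mp h
  norm_num [WeierstrassCurve.b₂] at key

/-- **`X2.CellB (5568g1) 3` from the rank reading alone**: `3 ≠ 2`, `E[3]` reducible (`not_irreducible_5568g1`),
`3` multiplicative (`nonsplit_5568g1`), `¬ GVPar` (`not_gvPar_5568g1`). [folklore] -/
theorem cellB_5568g1_of_analyticRank
    (hr : (⟨0, -1, 0, -493089, 628457121⟩ : WeierstrassCurve ℚ).analyticRank = 0) :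
    X2.CellB (⟨0, -1, 0, -493089, 628457121⟩ : WeierstrassCurve ℚ) 3 :=
  ⟨hr, ⟨by decide, not_irreducible_5568g1, nonsplit_5568g1.1⟩, not_gvPar_5568g1⟩

/-! ## §2 The partner `Wd = 5568g1 ⊗ χ_{−23}` -/

/-- `Wd = [0, −1, 0, −260844257, −7644351037599]` (PARI `ellminimalmodel(elltwist(5568g1, −23))`, kit j311785) is elliptic
(`Δ = 23⁶ · Δ(5568g1) ≠ 0`). [folklore] -/
theorem isElliptic_twist23 : (⟨0, -1, 0, -260844257, -7644351037599⟩ : WeierstrassCurve ℚ).IsElliptic :=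
  isElliptic_of_discOf_ne_zero 0 (-1) 0 (-260844257) (-7644351037599) (by decide +kernel)

set_option maxRecDepth 100000 in
/-- `Wd` is globally minimal (bounded Kraus–Silverman criterion, `decide`; `v₂₃(Δ) = 6 < 12`, `3 ∤ c₄`, the `2`-adic
pattern of `5568g1` scaled by `23`-adic units). [cite: SilvermanAEC2009, VII.1 Remark 1.1] -/
theorem isGloballyMinimal_twist23 : (⟨0, -1, 0, -260844257, -7644351037599⟩ : WeierstrassCurve ℚ).IsGloballyMinimal :=
  isGloballyMinimal_of_krausCriterion_bounded 0 (-1) 0 (-260844257) (-7644351037599)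
    (by decide +kernel) (by decide +kernel) (by decide +kernel)

/-- **The twist identity**: `⟨1, −8, 0, 0⟩⁻¹ • Wd = 5568g1.quadraticTwist (−23)` (`quadraticTwist d = [0, d·b₂/4, 0,
d²·b₄/2, d³·b₆/4] = [0, 23, 0, −260844081, −7646437791207]`; the shift `x ↦ x − 8` returns the reduced model). [folklore] -/
theorem exists_variableChange_twist23 :
    ∃ C : VariableChange ℚ, C • (⟨0, -1, 0, -260844257, -7644351037599⟩ : WeierstrassCurve ℚ) =
      (⟨0, -1, 0, -493089, 628457121⟩ : WeierstrassCurve ℚ).quadraticTwist ((-23 : ℤ) : ℚ) := by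
  refine ⟨(⟨1, -8, 0, 0⟩ : VariableChange ℚ)⁻¹, ?_⟩
  rw [inv_smul_eq_iff]
  ext <;> norm_num [quadraticTwist, WeierstrassCurve.variableChange_a₁,
    WeierstrassCurve.variableChange_a₂, WeierstrassCurve.variableChange_a₃,
    WeierstrassCurve.variableChange_a₄, WeierstrassCurve.variableChange_a₆, WeierstrassCurve.b₂,
    WeierstrassCurve.b₄, WeierstrassCurve.b₆]

/-! ## §3 The partner field `K = ℚ(√−23)`: every door clause from `d_K = −23` -/

/-- The primes dividing `5568 = 2⁶·3·29` are `2`, `3`, `29`. [folklore] -/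
theorem eq_of_prime_dvd_5568 {q : ℕ} (hq : q.Prime) (h : q ∣ 5568) : q = 2 ∨ q = 3 ∨ q = 29 := by
  have h' : q ∣ 2 ^ 6 * (3 * 29) := by norm_num at h ⊢; exact h
  rcases (Nat.Prime.dvd_mul hq).mp h' with h2 | h329
  · exact Or.inl ((Nat.prime_dvd_prime_iff_eq hq Nat.prime_two).mp (hq.dvd_of_dvd_pow h2))
  · rcases (Nat.Prime.dvd_mul hq).mp h329 with h3 | h29
    · exact Or.inr (Or.inl ((Nat.prime_dvd_prime_iff_eq hq Nat.prime_three).mp h3))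
    · exact Or.inr (Or.inr ((Nat.prime_dvd_prime_iff_eq hq (by norm_num)).mp h29))

/-- **Heegner hypothesis for `N = 5568` in any quadratic field of discriminant `−23`** (Kronecker criterion:
`−23 ≡ 1 (mod 8)`, `(−23/3) = (−23/29) = +1`). [cite: GrossLMS1991, §1 (p. 235)] -/
theorem satisfiesHeegnerHypothesis_5568 {K : Type} [Field K] [NumberField K]
    (h2 : Module.finrank ℚ K = 2) (hdK : NumberField.discr K = -23) : SatisfiesHeegnerHypothesis 5568 K := by
  refine (satisfiesHeegnerHypothesis_iff_kronecker 5568 K h2).mpr fun p hp hpN ↦ ?_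
  rw [hdK]
  rcases eq_of_prime_dvd_5568 hp hpN with rfl | rfl | rfl <;> norm_num

/-- **Heegner hypothesis for `p = 3`** in any quadratic field of discriminant `−23` (`(−23/3) = +1`: `3` splits in `K`).
[cite: GrossLMS1991, §1 (p. 235)] -/
theorem satisfiesHeegnerHypothesis_3 {K : Type} [Field K] [NumberField K]
    (h2 : Module.finrank ℚ K = 2) (hdK : NumberField.discr K = -23) : SatisfiesHeegnerHypothesis 3 K := by
  refine (satisfiesHeegnerHypothesis_iff_kronecker 3 K h2).mpr fun p hp hp3 ↦ ?_
  rw [hdK]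
  obtain rfl : p = 3 := (Nat.prime_dvd_prime_iff_eq hp Nat.prime_three).mp hp3
  norm_num

/-! ## §4 The display -/

/-- **PER-PAIR DISPLAY through the twistback door: `X2.MazurMainConjectureAt (5568g1) 3`** from, BY NAME, the route's
`PublishedInputs` and Disegni 2020 Thm. 4(1); PER PAIR: the Heegner datum over a quadratic field `K` of discriminant `−23`
(`Dt`, `H`, `ι`, `P`, `hPt`, `hcM`), STEP L at that datum (`hlow`; item -27489 ⇐ Keller–Yin Thm. D [PRE] + PUB), and FOUR
instrument readings — `hr` (`r_an(5568g1) = 0`), `hN` (`N = 5568`), `hrd` (`r_an(Wd) = 1`), and the two-engine certificate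
`hμ0`/`hlam` (`(μ_an, λ_an)(Wd, 3) = (0, 1)`) for the partner `Wd = 5568g1 ⊗ χ_{−23}` (globally minimal model, PROVED);
everything else — `X2.CellB`, non-split `3`, `IsImaginaryQuadratic K`, `Odd d_K`, `d_K < −4`, the Heegner hypotheses for
`5568` and `3`, and the twist identity — is discharged in the kernel. Conditional on the readings and the PRE-tier STEP L;
nothing booked; BSD / MC proved for no curve unconditionally. [cite: GreenbergVatsal2000, Thm. (1.3) with pp. 14–15, p. 4]
[cite: Disegni2020, Thm. 4 (§3.2)] [cite: SteinWuthrich2013, Thm. 6.1 (p. 20), §4.2] [cite: Wuthrich2014, Thm. 16 (p. 397)]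
[cite: JetchevSkinnerWan2017, §7.4.1] -/
theorem mazurMainConjectureAt_5568g1_at_three_of_partner23
    (hP : EisensteinPrimes.PublishedInputs) (hDis : padicBSD_rankOne_nonsplitMult)
    (W : WeierstrassCurve ℚ) [W.IsElliptic] [W.IsGloballyMinimal] (hW : W = ⟨0, -1, 0, -493089, 628457121⟩)
    (hr : W.analyticRank = 0)
    (K : Type) [Field K] [NumberField K] (h2 : Module.finrank ℚ K = 2) (hdK : NumberField.discr K = -23)
    (Dt : ModularParametrizationData W 5568) (H : HeegnerDatum 5568 (NumberField.discr K)) (ι : K →+* ℂ)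
    (P : (W.baseChange K).toAffine.Point) (hN : W.conductorNorm ℤ = 5568)
    (hPt : WeierstrassCurve.Affine.Point.map ι.toRatAlgHom P = heegnerPointComplex Dt H)
    (hcM : ¬ ((3 : ℕ) : ℤ) ∣ Dt.c)
    (Wd : WeierstrassCurve ℚ) [Wd.IsElliptic] [Wd.IsGloballyMinimal]
    (hWd : Wd = ⟨0, -1, 0, -260844257, -7644351037599⟩) (hrd : Wd.analyticRank = 1)
    (hlow : Finite (W.baseChange K).sha → X11b.IndexLowerBoundAt W 3 K P)
    (hμ0 : X2.AnalyticMuLE Wd 3 0) (hlam : X2.AnalyticLambdaEq Wd 3 1) :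
    X2.MazurMainConjectureAt W 3 := by
  subst hW hWd
  have hK : IsImaginaryQuadratic K := isImaginaryQuadratic_of_discr_eq_of_neg h2 hdK (by norm_num)
  have hodd : Odd (NumberField.discr K) := by rw [hdK]; exact ⟨-12, by norm_num⟩
  have hlt : NumberField.discr K < -4 := by rw [hdK]; norm_num
  have hWd' : ∃ C : VariableChange ℚ, C • (⟨0, -1, 0, -260844257, -7644351037599⟩ : WeierstrassCurve ℚ) =
      (⟨0, -1, 0, -493089, 628457121⟩ : WeierstrassCurve ℚ).quadraticTwist (NumberField.discr K : ℚ) := by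
    rw [hdK]; exact exists_variableChange_twist23
  exact mazurMainConjectureAt_of_cellB_of_not_split_of_indexLowerBoundAt_of_lamMin_twist hP hDis _ 3
    (cellB_5568g1_of_analyticRank hr) nonsplit_5568g1.2 5568 K Dt H ι P hK hodd hlt hN
    (satisfiesHeegnerHypothesis_5568 h2 hdK) (satisfiesHeegnerHypothesis_3 h2 hdK) hPt hcM _ hWd' hrd hlow hμ0 hlam

end Summit.BirchSwinnertonDyer.BirchSwinnertonDyer.Theorems.EisensteinPrimesMazurMCOnCellBTwistbackDisplay5568g1

end
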